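import Summits.Langlands.Langlands.Theorems.PicardMuOrdinaryMuOrdinaryFamilyRTThornePAIKillSubgroup
import Summits.Langlands.Langlands.Theorems.PicardMuOrdinaryMuOrdinaryFamilyRTThornePointUnramified
import HarnessLib

/-!
# PA-I glue H4 = G6b: a character killed on an open piece of local inertia at `w` is trivial on the
# global inertia groups over the places of `L` above `w` (stub of `stub_thorneInputOverL`, line thorne-minimal-lift)

Crux `Summit.Langlands.Langlands.Theses.PicardMuOrdinary.MuOrdinaryFamilyRT`, line
thorne-minimal-lift.  In the assembly of the Galois input of Thorne's Thm 5.1 over the soluble CM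
extension `L/F'` (`stub_thorneInputOverL`), the twisting character `θ : Γ_{F'} → ℚ̄₃ˣ` is known to be
trivial on `I_{F'_w} ∩ U` for an OPEN subgroup `U ≤ Γ_{F'_w}` (a "kill subgroup"), and `L` is chosen
(CHT 2008, Lemma 4.1.2) so that at every place `u ∣ w` of `L` the whole local Galois group `Γ_{L_u}`
restricts into `U` along the local base-change map `F'_w → L_u`.  The glue statement H4 = G6b concludes
that `θ ∘ res_{F'}^L` kills every GLOBAL inertia group `I_𝔓 ≤ Γ_L`, `𝔓 ∣ u` a prime of `\bar ℤ_L` — the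
form in which unramifiedness of the twist `ρ ⊗ θ` over `L` is consumed (`FramedGaloisRep.IsUnramifiedAt`).

* `ofCharacter_apply_eq_one_iff` (§ 1): for the rank-one framed representation `ofCharacter χ` of a
  continuous character `χ : G → Aˣ` (tree `FramedRep.ofCharacter`, through the isomorphism
  `Aˣ ≃ GL_1(A)`), `ofCharacter χ g = 1 ↔ χ g = 1`.
* `char_eq_one_inertia_of_local` (§ 2, H4 = G6b, registered): frame `θ` as `θ₁ = ofCharacter θ :
  Γ_{F'} → GL_1(ℚ̄₃)`; the hypothesis is a kill subgroup for `θ₁` at `w`; along the `F'`-compatible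
  algebra structure `adicCompletionOfLiesOver F' L w u : F'_w → L_u` (scalar tower
  `isScalarTower_adicCompletionOfLiesOver`) the containment `res_{F'_w}^{L_u}(Γ_{L_u}) ⊆ U` makes
  `θ₁|Γ_L` unramified at `u` (`isUnramifiedAt_restrictField_of_openSubgroup`: decomposition transport
  `res_{F'}^L ∘ res_L^{L_u} = γ · (res_{F'}^{F'_w} ∘ res_{F'_w}^{L_u}) · γ⁻¹`, `res(I_{L_u}) ⊆ I_{F'_w}`, and the
  LOCAL CRITERION `isUnramifiedAt_iff_forall_absInertia`, Neukirch II (9.6): `I_𝔓` is conjugate to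
  `res_L^{L_u}(I_{L_u})`), i.e. `θ₁(res_{F'}^L σ) = 1` for `σ ∈ I_𝔓`, `𝔓 ∣ u`; unframe by § 1.

References: J. Thorne, *A 2-adic automorphy lifting theorem for unitary groups over CM fields*,
Math. Z. 285 (2017), Thm 5.1 (iv); L. Clozel, M. Harris, R. Taylor, Publ. Math. IHÉS 108 (2008),
Lemma 4.1.2; J. Neukirch, *Algebraic Number Theory* (1999), Ch. II §9, Prop. (9.6); J.-P. Serre,
*Abelian ℓ-adic representations* (1968), Ch. I §2.1.  No named fact, no definition.
-/

set_option linter.dupNamespace false -- `Summit.Langlands.Langlands.…` is the problem's namespace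

namespace Summit.Langlands.Langlands.Cruxes.MuOrdinaryFamilyRT.ThorneMinimalLift

open scoped NumberField Polynomial Matrix Classical
open Field IsDedekindDomain Polynomial
open Literature.NumberTheory.GaloisRepresentations Literature.NumberTheory.Automorphic
open Summit.Langlands.Langlands.Cruxes.MuOrdinaryFamilyRT.CharZeroDominance

noncomputable section

/-! ## 1. Rank-one framing of a character -/

section General

variable {G : Type*} [Group G] [TopologicalSpace G] {A : Type*} [CommRing A] [TopologicalSpace A]

/-- **Unframing.**  For a continuous character `χ : G → Aˣ`, the rank-one framed representation
`ofCharacter χ : G → GL_1(A)` (the character pushed through the isomorphism of topological groups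
`Aˣ ≃ GL_1(A)`, `FramedRep.unitsContinuousMulEquivOfUnique`) takes the value `1` at `g` iff `χ g = 1`. -/
theorem ofCharacter_apply_eq_one_iff (χ : G →ₜ* Aˣ) (g : G) : FramedRep.ofCharacter χ g = 1 ↔ χ g = 1 := by
  change FramedRep.unitsContinuousMulEquivOfUnique (Fin 1) A (χ g) = 1 ↔ _
  exact map_eq_one_iff _ (FramedRep.unitsContinuousMulEquivOfUnique (Fin 1) A).injective

end General

/-! ## 2. H4 = G6b: from a local kill subgroup at `w` to the global inertia groups over `L` -/

/-- **H4 = G6b** (PA-I glue of `stub_thorneInputOverL`).  Let `θ : Γ_{F'} → ℚ̄₃ˣ` be a continuous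
character of the number field `F'`, `w` a finite place of `F'` and `U ≤ Γ_{F'_w}` an open subgroup with
`θ(res_{F'}^{F'_w} τ) = 1` for all `τ ∈ I_{F'_w} ∩ U`.  Let `L ⊇ F'` be a number field and `u ∣ w` a place of
`L` such that, along the local base-change map `F'_w → L_u` (`adicCompletionOfLiesOver`), the restriction
`res_{F'_w}^{L_u}` sends ALL of `Γ_{L_u}` into `U`.  Then `θ(res_{F'}^L σ) = 1` for every `σ` in every inertia
group `I_𝔓 ≤ Γ_L`, `𝔓 ∣ u` a prime of `\bar ℤ_L`: the rank-one framing `ofCharacter θ` restricted to `Γ_L` is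
unramified at `u` by `isUnramifiedAt_restrictField_of_openSubgroup` (decomposition transport + the local
criterion `isUnramifiedAt_iff_forall_absInertia`), and `ofCharacter θ (·) = 1 ↔ θ (·) = 1`. -/
theorem char_eq_one_inertia_of_local : ∀ (F' : Type) [Field F'] [NumberField F'] (L : Type) [Field L] [NumberField L] [Algebra F' L] (θ : absoluteGaloisGroup F' →ₜ* (PadicAlgCl 3)ˣ) (w : HeightOneSpectrum (𝓞 F')) (U : OpenSubgroup (absoluteGaloisGroup (w.adicCompletion F'))), (∀ τ ∈ absInertia (w.adicCompletion F'), τ ∈ U → θ (absGaloisRestrict F' (w.adicCompletion F') τ) = 1) → ∀ (u : HeightOneSpectrum (𝓞 L)) (_ : u.asIdeal.LiesOver w.asIdeal), (letI := (adicCompletionOfLiesOver F' L w u).toAlgebra; ∀ τ : absoluteGaloisGroup (u.adicCompletion L), absGaloisRestrict (w.adicCompletion F') (u.adicCompletion L) τ ∈ U) → ∀ 𝔓 ∈ u.primesAbove, ∀ σ ∈ 𝔓.inertia (absoluteGaloisGroup L), θ (absGaloisRestrict F' L σ) = 1 := by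
  intro F' _ _ L _ _ _ θ w U hU u hu hLU 𝔓 h𝔓 σ hσ
  letI := (adicCompletionOfLiesOver F' L w u).toAlgebra
  haveI := isScalarTower_adicCompletionOfLiesOver (F := F') (E := L) w u
  have hunr : (FramedGaloisRep.restrictField L (FramedRep.ofCharacter θ)).IsUnramifiedAt u :=
    isUnramifiedAt_restrictField_of_openSubgroup (FramedRep.ofCharacter θ) w U
      (fun τ hτ hτU => (ofCharacter_apply_eq_one_iff θ _).2 (hU τ hτ hτU)) u fun τ _ => hLU τ
  have h1 := hunr 𝔓 h𝔓 σ hσ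
  rw [FramedGaloisRep.restrictField_apply] at h1
  exact (ofCharacter_apply_eq_one_iff θ _).1 h1

end

end Summit.Langlands.Langlands.Cruxes.MuOrdinaryFamilyRT.ThorneMinimalLift
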